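import Literature.MathematicalPhysics.QuantumFieldTheory.BalabanImbrieJaffe1984to88.BIJ88Decay241RegularTorusCwt

/-!
# `BalabanImbrieJaffe1984to88.BIJ88Decay241RegularTorusCwtUniform` — T. Bałaban, J. Imbrie, A. Jaffe, *Effective action and cluster properties
of the abelian Higgs model*, Commun. Math. Phys. **114** (1988) 257–315 [BalabanImbrieJaffe1988], §2 (2.41) p. 264 [PDF 8]: **(2.41) FOR
`Δ_{k,loc}(e^{ieεA})` WITH `Ω = T_η` AT A (2.23)-REGULAR `A`, FOR THE PRINTED LOCALIZATION DATA WITH BIG-BLOCK CUBES, WITH THE CONSTANTS CHOSEN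
BEFORE THE INSTANCE** — gen 21's `BIJ88Decay241RegularTorusCwt.decay241_regular_torus_cwt` (p349307) carries print's largeness/smallness conditions
(*"by (2.38), C^{(k)}_Λ(u)^{−1} is bounded below"*: the condition `hE` on the (7.3.2) field-strength term and the (2.35) localization bracket,
and the walk-expansion smallness `hsmall`) as displayed numeric hypotheses; this file DISCHARGES them by thresholds depending only on
`(d, L, a, e, c, β, κ̂, M_max, s)`: `e_k ≤ e₁`, `(2c·e_k^β)² ≤ θ₀`, radii `R ≥ ρ₀L^k` (beyond the row margin) and `R₁ ≥ ρ₀L^k` (print's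
*"O(r(e_k))"*, `r(e_k) → ∞`), at most `M_max` cubes active on a block row (print: `O(1)`), and the averaged-field smallness with `σ = ½`.

statement-level skeleton of published theorems with citation tags; proofs where landed; nothing here is a claim about the Yang–Mills mass gap

PDF held: `paper:balaban1988-cmp114-bij-abelian-higgs-effective-action` (journal page = PDF page + 256; p. 264 = PDF 8).

CITATION HEADER (lean-in-tree rule).  lit-balaban cell (HOME `run/shared/lean/pub/lit-balaban/`), Phase 2, proof seat **p31 gen 21** (unit
`lit-balaban-p31`, literature-prover-lit-balaban-p31-g21-0), free-target protocol G.5-34(d), TAKING #5 line HOME/STATUS.md 2026-08-23T04:11:58Z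
(own lineage; stem check `…RegularTorusCwtUniform…` = ∅; notice to r18).  Rows of `HOME/lit-balaban-r18/ROWS-C2.md` served (LOCATED MEMBER, cells
only; heads unchanged; owner r18): **C2.Eq2.41** «`Δ_{k,loc}(e^{ieεA})`, (2.23)-regular `A`, printed data with big-block cubes, constants before
the instance»; v1.1 (§2, append-only, TAKING #6): **C2.Eq2.40** and ROWS-C3 **(4.9)_{j≥1}** «same, constants before the instance».  USED BY NAME:
gen 21's `BIJ88Decay241RegularTorusCwt.decay241_regular_torus_cwt` / `Z49_regular_torus_cwt` (everything else through them).

## The print (verbatim, p. 264 [PDF 8])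

*"We define C^{(k)}_Λ(u) = [(Δ_{k,loc}(u) + aL^{−2} Q(u_k)^* Q(u_k))|_Λ]^{−1}. (2.40) This is of course a nonlocal operator, but by (2.38),
C^{(k)}_Λ(u)^{−1} is bounded below and a random walk expansion as in [6] can be used to prove that |C^{(k)}_Λ(u; x₁, x₂)| ≦ ce^{−c|x₁−x₂|}. (2.41)"*
(v1.2 DOC-ONLY, gen 22: this block is now the verbatim print — PDF p0008 L2–15, referee asks ref-1 g78/g79 and ref-5 D-g65-3: the printed
(2.38) carries the support condition on φ; (2.39) is the region propagator C^{(k)}_Λ(Ω,u), (2.40) the localized C^{(k)}_Λ(u); the earlier text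
«An important consequence of (2.35) …» / «… bounded below (2.40)» was a paraphrase with the labels (2.39)/(2.40) swapped. No declaration changed.) — with `c` depending on the fixed parameters only; the radii of the localization (2.27)/(2.29)
are `O(r(e_k))` and *"each G_k(□_α,u) is close to G_k(Ω,u) for the relevant x₁, x₂"* (p. 263), so the (2.35) error `e^{−cr(e_k)}` is small once
`e_k` is small.

## What is proved (0 `sorry`; theorems only — no definition, no `Prop`-valued fact)

* **`decay241_regular_torus_cwt_uniform`** — for `d + 1` directions, `L ≥ 2`, `a > 0`, `e`, `(c, β)`, `κ̂ > 0` and a multiplicity bound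
  `M_max`: `∃ s₀ ∀ s ≥ s₀ ∃ e₁ θ₀ ρ₀ δ₁ c₂ > 0` such that on every torus of the series, every level `1 ≤ k ≤ K` with `k + s ≤ m + K`,
  `k + 1 ≤ m + K`, `3L^kL^s ≤ |T^{(0)}|`, every `A` (2.23)-regular on `T^{(0)}` with `0 < e_k ≤ e₁` and `(2c·e_k^β)² ≤ θ₀`, every reference
  no-wrap box `Ω₀` with torus gap `≥ R`, spacing `s_g ≥ 1`, half-width `W ≥ 2s_g/3 + R₀/2 + R`, radii `R ≥ rowMargin + ρ₀L^k`,
  `ρ₀L^k ≤ R₁ < R₀`, multiplicity `(⌊(L^k − 1 + R₀)/s_g⌋ + 3)^{d+1} ≤ M_max`, every `Λ` of `k`-sites whose blocks lie in `Ω₀` at chart depth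
  `≥ R₀ + R`, and every averaged-field smallness `(T₁, δ′)` of `u_k` with `2(L−1)L·d′·T₁² + 2δ′² ≤ ½`:
  **`‖C^{(k)}_Λ(u; x₁, x₂)‖ ≤ (a_k/A)·c₂·e^{−δ₁|x₁−x₂|_{T^{(k)}}}`** for all `x₁, x₂ ∈ Λ`, `u = e^{ieεA}`,
  `C^{(k)}_Λ(u) = [(Δ_{k,loc}(u) + (A/a_k)κ̂P(u_k))|_Λ]^{−1}` built on the big-block cubes `cubeFamB`, weights `λ_α` and cut-off `ζ″` of record.
* §2 (v1.1) **`Z49_regular_torus_cwt_uniform`** — (2.40) and (4.9)_{j≥1} with the constants chosen before the instance: `∃ s₀ ∀ s ≥ s₀ ∃ e₁ θ₀ ρ₀ > 0`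
  such that, under the same data without the decay-rate smallness, for all `E_s, N`: `realify((Δ_{k,loc}(u) + (A/a_k)κ̂P(u_k))|_Λ)` is positive
  definite, `Z^{(k)}_Λ = e^{−E_sN}(2π)^{#(Λ×2)/2}/√det(…)`, `Z^{(k)}_Λ > 0` — gen 21's `Z49_regular_torus_cwt` BY NAME, its `hE` discharged.

HONEST SCOPE / DIVERGENCE.  (i) Exactly gen 21's located member with its two numeric conditions discharged: the (7.3.2) term by
`(2c·e_k^β)² ≤ θ₀`, the (2.35) bracket by `R, R₁ ≥ ρ₀L^k` through `e^{−x} ≤ 1/(1+x)` (`Real.add_one_le_exp`), the walk-expansion smallness by the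
choice of the rate `δ₁ = min(δ₀/4, c_S/(8(W_max+1)))`, `δ₀ = 1/(8L^s)`, `c_S = c240(γ₀, κ̂)`; `a_k ≤ a` (`B1.aSeq_le`).  (ii) `e₁`, `ρ₀`, `δ₁`, `c₂`
depend on the existential `c₀(s)` of r01's providers (through gen 21 / r18), hence are existential themselves — explicit in the proof as
functions of `(d, L, a, κ̂, M_max, s, c₀)`.  (iii) `M_max` is an INPUT (print's `O(1)` cubes per row; for `s_g ≥ L^k + R₀` one may take
`3^{d+1}`).  (iv) Scope as gen 21's file: `Ω = T_η`, `u = e^{ieεA}` exactly, big-block hulls, value members, `σ = ½`.  Imports: gen 21's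
`BIJ88Decay241RegularTorusCwt` only.  Literature + Mathlib only.  Unit `lit-balaban-p31` (literature-prover-lit-balaban-p31-g21-0), 2026-08-23.
NOT summit progress.
-/

open scoped BigOperators Matrix ComplexConjugate
open Finset Matrix

namespace Literature.MathematicalPhysics.QuantumFieldTheory.BalabanImbrieJaffe1984to88.BIJ88Decay241RegularTorusCwtUniform

open Literature.MathematicalPhysics.QuantumFieldTheory.Balaban1983to89
open BIJ88Sect3Statements (U1 toC)
open BIJ85BlockAveragesTorus BIJ85BlockAveragesTorusK
open BIJ88DeltaLoc234Torus (deltaLocT)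
open BIJ88NeumannPropagatorFlatDecayCube (cubeT boxCoord)
open BIJ88Cutoffs21 (cutoff)
open BIJ88LocWeights227Torus (lamFam labels)
open BIJ85CovariantHiggsDictionary (expGauge)
open BIJ88Close231RegularTorusCwt (cubeFamB rowMargin)
open BIJ88Eq240FlatTorus (compress op240 c240)
open B4Sect5Proof (latticeConst latticeConst_nonneg)
open BIJ88Decay241RegularTorusCwt (decay241_regular_torus_cwt)

noncomputable section

/-- kernel: `e^{−x} ≤ η` once `x ≥ 1/η`, `η > 0` (`x + 1 ≤ e^x`). [folklore] -/
private theorem exp_neg_le_of_inv_le {x η : ℝ} (hη : 0 < η) (hx : 1 / η ≤ x) : Real.exp (-x) ≤ η := by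
  have hx0 : 0 < x := lt_of_lt_of_le (by positivity) hx
  have h1 : x + 1 ≤ Real.exp x := Real.add_one_le_exp x
  rw [Real.exp_neg]
  have h2 : (Real.exp x)⁻¹ ≤ (x + 1)⁻¹ := inv_anti₀ (by positivity) h1
  refine h2.trans ?_
  rw [inv_le_comm₀ (by positivity) hη]
  have : η⁻¹ = 1 / η := (one_div η).symm
  linarith

/-- **(2.41) FOR `Δ_{k,loc}(e^{ieεA})`, `Ω = T_η`, AT A (2.23)-REGULAR `A`, FOR THE PRINTED DATA WITH BIG-BLOCK CUBES — CONSTANTS CHOSEN BEFORE THE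
INSTANCE** (p. 264: *"This is of course a nonlocal operator, but by (2.38), C^{(k)}_Λ(u)^{−1} is bounded below and a random walk expansion as
in [6] can be used to prove that |C^{(k)}_Λ(u; x₁, x₂)| ≦ ce^{−c|x₁−x₂|}. (2.41)"*).  For `d + 1` directions, `L ≥ 2`, `a > 0`, `e`, `(c, β)`, `κ̂ > 0`, `M_max`: `∃ s₀`, `∀ s ≥ s₀`,
`∃ e₁ θ₀ ρ₀ δ₁ c₂ > 0` (from `(d, L, a, e, c, β, κ̂, M_max, s)` only) such that on every torus of the series, at every level `1 ≤ k ≤ K` with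
`k + s ≤ m + K`, `k + 1 ≤ m + K`, `3L^kL^s ≤ |T^{(0)}|`, for every `A` (2.23)-regular on `T^{(0)}` with `0 < e_k ≤ e₁`, `(2c·e_k^β)² ≤ θ₀`, every
reference no-wrap box `Ω₀ = c·L^k + Π_i[0, L^kM₀_i)` with torus gap `≥ R`, spacing `s_g ≥ 1`, half-width `W ≥ 2s_g/3 + R₀/2 + R`, radii
`R ≥ rowMargin + ρ₀L^k`, `ρ₀L^k ≤ R₁ < R₀`, multiplicity `(⌊(L^k − 1 + R₀)/s_g⌋ + 3)^{d+1} ≤ M_max`, every `Λ` of `k`-sites whose blocks lie in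
`Ω₀` with chart margin `R₀ + R`, every averaged-field smallness `‖u_k(b) − 1‖ ≤ T₁` (intra-block), `‖u_k(Γ_{yx}) − 1‖ ≤ δ′`,
`2(L−1)L·d′·T₁² + 2δ′² ≤ ½`: **`‖C^{(k)}_Λ(u; x₁, x₂)‖ ≤ (A/a_k)^{−1}·c₂·e^{−δ₁|x₁−x₂|_{T^{(k)}}}`** for all `x₁, x₂ ∈ Λ`, `u = e^{ieεA}` — gen 21's
`decay241_regular_torus_cwt` BY NAME with `σ = ½`, `κ′ = κ̂`, its `hE`/`hsmall` discharged by the thresholds. [cite: BalabanImbrieJaffe1988, (2.41) p.264] -/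
theorem decay241_regular_torus_cwt_uniform (d L : ℕ) (hL : 2 ≤ L) {a : ℝ} (ha : 0 < a) (e creg β : ℝ) (hcreg : 0 ≤ creg)
    (hβ : 0 < β) {κ' : ℝ} (hκ' : 0 < κ') (Mmax : ℕ) :
    ∃ s₀ : ℕ, ∀ s : ℕ, s₀ ≤ s → ∃ e₁ θ₀ ρ₀ δ₁ c₂ : ℝ, 0 < e₁ ∧ 0 < θ₀ ∧ 0 < ρ₀ ∧ 0 < δ₁ ∧ 0 < c₂ ∧
      ∀ (P : Params) (hPd : P.d = d + 1), P.L = L → ∀ (k : ℕ), 1 ≤ k → k ≤ P.K → k + s ≤ P.m + P.K → k + 1 ≤ P.m + P.K →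
      3 * (L ^ k * L ^ s) ≤ P.sitesPerDir 0 →
      ∀ (A : PBond P 0 → ℝ) (ec : ℝ), 0 < ec → ec ≤ e₁ →
      (∀ (z : Balaban1983to89.Site P 0) (μ ν : Fin P.d),
          P.spacing k * |e| / ec * |A ⟨z.shift μ, ν⟩ - A ⟨z, ν⟩| ≤ creg * ec ^ (β - 1) / (L : ℝ) ^ k) →
      (2 * creg * ec ^ β) ^ 2 ≤ θ₀ →
      ∀ (c M0 : Fin (d + 1) → ℕ), (∀ i, c i * P.L ^ k + P.L ^ k * M0 i ≤ P.sitesPerDir 0) →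
      ∀ (sg W : ℕ), 1 ≤ sg → ∀ (R R₀ R₁ : ℝ), ((rowMargin L (d + 1) k s : ℕ) : ℝ) + ρ₀ * (L : ℝ) ^ k ≤ R → ρ₀ * (L : ℝ) ^ k ≤ R₁ →
        R₁ < R₀ → ((⌊(((P.L : ℝ) ^ k) - 1 + R₀) / sg⌋₊ + 3) ^ (d + 1) ≤ Mmax) →
        2 * (sg : ℝ) / 3 + R₀ / 2 + R ≤ W → (∀ i, ((P.L ^ k * M0 i : ℕ) : ℝ) + R ≤ P.sitesPerDir 0) →
      ∀ (Λ : Finset (Balaban1983to89.Site P (0 + k))),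
        (∀ y₁ ∈ Λ, ∀ μ, (c (Fin.cast hPd μ) : ℝ) * P.L ^ k + (R₀ + R) ≤ (P.L : ℝ) ^ k * (y₁ μ).val ∧
          (P.L : ℝ) ^ k * (y₁ μ).val + P.L ^ k + (R₀ + R) ≤ (c (Fin.cast hPd μ) : ℝ) * P.L ^ k + (P.L : ℝ) ^ k * M0 (Fin.cast hPd μ)) →
      ∀ (T₁ δ' : ℝ),
        (∀ b : PBond P (0 + k), blkIter 1 b.src = blkIter 1 b.tgt → ‖toC (lineIter (expGauge P e A) k b) - 1‖ ≤ T₁) →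
        (∀ y : Balaban1983to89.Site P (0 + k), ‖holCK (lineIter (expGauge P e A) k) 1 y - 1‖ ≤ δ') →
        2 * (((P.L : ℝ) - 1) * P.L) * P.d * T₁ ^ 2 + 2 * δ' ^ 2 ≤ 1 / 2 →
      ∀ (x₁ x₂ : ↥Λ),
        ‖(compress Λ (op240 (deltaLocT (B1RG242Torus.α P a k * (P.L : ℝ) ^ (k * P.d)) P.eps⁻¹ (expGauge P e A) k
            (cubeFamB hPd (P.L ^ k) c M0 sg W (L ^ k * L ^ s)) (lamFam hPd (P.L ^ k) c M0 sg) (cutoff R₁ R₀ (B5Ineq137Torus.T P 0)))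
            ((B1RG242Torus.α P a k * (P.L : ℝ) ^ (k * P.d)) / B1.aSeq a P.L k * κ') (lineIter (expGauge P e A) k)))⁻¹ x₁ x₂‖ ≤
          ((B1RG242Torus.α P a k * (P.L : ℝ) ^ (k * P.d)) / B1.aSeq a P.L k)⁻¹ * c₂ *
            Real.exp (-(δ₁ * B5Ineq137Torus.T P (0 + k) x₁ x₂)) := by
  obtain ⟨s₀, H⟩ := decay241_regular_torus_cwt d L hL ha e creg β hcreg hβ
  refine ⟨s₀, fun s hs => ?_⟩
  obtain ⟨c₀, e₁, hc₀, he₁, M⟩ := H s hs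
  clear H
  have hLr2 : (2 : ℝ) ≤ L := by exact_mod_cast hL
  have hL0 : (0 : ℝ) < L := by linarith
  have hLL : (0 : ℝ) < 2 * (((L : ℝ) - 1) * L) := by nlinarith only [hLr2]
  -- the constants, as opaque abbreviations with their defining equations (functions of `(d, L, a, κ̂, M_max, s, c₀)`)
  obtain ⟨δ₀, hδ₀⟩ : ∃ x : ℝ, x = 1 / (8 * (L : ℝ) ^ s) := ⟨_, rfl⟩
  have hδ₀0 : 0 < δ₀ := by rw [hδ₀]; positivity
  obtain ⟨g0, hg0⟩ : ∃ x : ℝ, x = min (a / (9 * ((d : ℝ) + 1 + 1))) (1 / 12) := ⟨_, rfl⟩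
  have hg00 : 0 < g0 := by rw [hg0]; exact lt_min (by positivity) (by norm_num)
  obtain ⟨cS, hcS⟩ : ∃ x : ℝ, x = min (g0 / (2 * (((L : ℝ) - 1) * L))) (κ' / (2 * (L : ℝ) ^ (d + 1))) := ⟨_, rfl⟩
  have hcS0 : 0 < cS := by rw [hcS]; exact lt_min (div_pos hg00 hLL) (by positivity)
  obtain ⟨K, hK⟩ : ∃ x : ℝ, x = latticeConst (d + 1) (δ₀ / 2) := ⟨_, rfl⟩
  have hK0 : 0 ≤ K := by rw [hK]; exact latticeConst_nonneg (d + 1) (half_pos hδ₀0).le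
  obtain ⟨Zd, hZd⟩ : ∃ x : ℝ, x = 4 / 3 * ((d : ℝ) + 1) ^ 4 := ⟨_, rfl⟩
  have hZd0 : 0 ≤ Zd := by rw [hZd]; positivity
  obtain ⟨θ₀, hθ₀⟩ : ∃ x : ℝ, x = cS / (8 * (Zd + 1)) := ⟨_, rfl⟩
  have hθ₀0 : 0 < θ₀ := by rw [hθ₀]; positivity
  obtain ⟨B, hB⟩ : ∃ x : ℝ, x = a ^ 2 * (c₀ * Real.exp (δ₀ / 2) * K) * ((Mmax : ℝ) + 1) := ⟨_, rfl⟩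
  have hB0 : 0 ≤ B := by rw [hB]; positivity
  obtain ⟨η, hη⟩ : ∃ x : ℝ, x = cS / (8 * (B + 1)) := ⟨_, rfl⟩
  have hη0 : 0 < η := by rw [hη]; positivity
  obtain ⟨ρ₀, hρ₀⟩ : ∃ x : ℝ, x = 2 / δ₀ * (1 / η) := ⟨_, rfl⟩
  have hρ₀0 : 0 < ρ₀ := by rw [hρ₀]; positivity
  obtain ⟨Wm, hWm⟩ : ∃ x : ℝ, x = 4 / δ₀ * (2 * K) *
      (a * (1 + (Mmax : ℝ) * a * (c₀ * Real.exp δ₀)) + κ' * (((L : ℝ) ^ (d + 1))⁻¹) ^ 2 * Real.exp (δ₀ * ((L : ℝ) - 1))) := ⟨_, rfl⟩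
  have hWm0 : 0 ≤ Wm := by rw [hWm]; positivity
  obtain ⟨ϑ, hϑ⟩ : ∃ x : ℝ, x = min (δ₀ / 4) (cS / (8 * (Wm + 1))) := ⟨_, rfl⟩
  have hϑ0 : 0 < ϑ := by rw [hϑ]; exact lt_min (by positivity) (by positivity)
  have hϑ4 : ϑ ≤ δ₀ / 4 := by rw [hϑ]; exact min_le_left _ _
  have hϑW : ϑ ≤ cS / (8 * (Wm + 1)) := by rw [hϑ]; exact min_le_right _ _
  have h1η : 1 / η = δ₀ / 2 * ρ₀ := by rw [hρ₀]; field_simp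
  refine ⟨e₁, θ₀, ρ₀, ϑ, 16 / cS, he₁, hθ₀0, hρ₀0, hϑ0, by positivity, ?_⟩
  intro P hPd hPL k hk1 hkK hks hk' hsize A ec hec hece hreg hθ c M0 hfit0 sg W hsg R R₀ R₁ hRρ hR₁ρ hR10 hMm hW hgap Λ hΛ T₁ δ'
    hInt hTree hσ x₁ x₂
  subst hPL
  have hdr : (P.d : ℝ) = (d : ℝ) + 1 := by rw [hPd]; push_cast; ring
  have hLk : (0 : ℝ) < (P.L : ℝ) ^ k := pow_pos hL0 k
  have hρL : 0 < ρ₀ * (P.L : ℝ) ^ k := mul_pos hρ₀0 hLk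
  have hRm : ((rowMargin P.L (d + 1) k s : ℕ) : ℝ) < R := by linarith only [hRρ, hρL]
  have hRρ' : ρ₀ * (P.L : ℝ) ^ k ≤ R := by
    linarith only [hRρ, (Nat.cast_nonneg _ : (0 : ℝ) ≤ (rowMargin P.L (d + 1) k s : ℕ))]
  have hR₁ : 0 ≤ R₁ := hρL.le.trans hR₁ρ
  -- normalization constants and the named pieces of gen 21's two numeric conditions
  have hak0 : 0 < B1.aSeq a P.L k := B1.aSeq_pos ha (B1RG242Torus.one_lt_cast_L P) hk1
  have hak_le : B1.aSeq a P.L k ≤ a := B1.aSeq_le ha (B1RG242Torus.one_lt_cast_L P) k hk1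
  have hKP : latticeConst P.d (1 / (8 * (P.L : ℝ) ^ s) / 2) = K := by rw [hK, hPd, hδ₀]
  have hcSP : c240 P (min (a / (9 * (P.d + 1))) (1 / 12)) κ' = cS := by rw [c240, hcS, hg0, hdr, hPd]
  have hm : ((⌊(((P.L : ℝ) ^ k) - 1 + R₀) / sg⌋₊ : ℝ) + 3) ^ (d + 1) ≤ (Mmax : ℝ) := by exact_mod_cast hMm
  set m : ℝ := ((⌊(((P.L : ℝ) ^ k) - 1 + R₀) / sg⌋₊ : ℝ) + 3) ^ (d + 1) with hmdef
  have hm0 : 0 ≤ m := by rw [hmdef]; positivity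
  -- the two exponential factors of the (2.35) bracket are `≤ η` (`R, R₁ ≥ ρ₀L^k`, `(δ₀/2)ρ₀ = 1/η`)
  have hexp2 : Real.exp (-(δ₀ * (((P.L : ℝ) ^ k)⁻¹ * (2 * R)))) ≤ η := by
    refine exp_neg_le_of_inv_le hη0 ?_
    have h2 : ρ₀ ≤ ((P.L : ℝ) ^ k)⁻¹ * (2 * R) := by
      rw [inv_mul_eq_div, le_div_iff₀ hLk]; linarith only [hRρ', hρL]
    rw [h1η]
    have h3 := mul_le_mul_of_nonneg_left h2 hδ₀0.le
    linarith only [h3, mul_pos hδ₀0 hρ₀0]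
  have hexp1 : Real.exp (-(δ₀ / 2 * (((P.L : ℝ) ^ k)⁻¹ * R₁))) ≤ η := by
    refine exp_neg_le_of_inv_le hη0 ?_
    have h2 : ρ₀ ≤ ((P.L : ℝ) ^ k)⁻¹ * R₁ := by
      rw [inv_mul_eq_div, le_div_iff₀ hLk]; exact hR₁ρ
    rw [h1η]
    exact mul_le_mul_of_nonneg_left h2 (by positivity)
  -- the (2.35) bracket term `≤ cS/8`
  have hBr : B1.aSeq a P.L k ^ 2 * (c₀ * Real.exp (δ₀ / 2) * K) *
      (m * Real.exp (-(δ₀ * (((P.L : ℝ) ^ k)⁻¹ * (2 * R)))) + Real.exp (-(δ₀ / 2 * (((P.L : ℝ) ^ k)⁻¹ * R₁)))) ≤ cS / 8 := by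
    have h1 : B1.aSeq a P.L k ^ 2 ≤ a ^ 2 := pow_le_pow_left₀ hak0.le hak_le 2
    have h2 : m * Real.exp (-(δ₀ * (((P.L : ℝ) ^ k)⁻¹ * (2 * R)))) + Real.exp (-(δ₀ / 2 * (((P.L : ℝ) ^ k)⁻¹ * R₁))) ≤
        ((Mmax : ℝ) + 1) * η := by
      have h21 := mul_le_mul hm hexp2 (Real.exp_pos _).le (Nat.cast_nonneg _)
      exact (add_le_add h21 hexp1).trans_eq (by ring)
    have h3 : 0 ≤ c₀ * Real.exp (δ₀ / 2) * K := by positivity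
    have h4 : 0 ≤ m * Real.exp (-(δ₀ * (((P.L : ℝ) ^ k)⁻¹ * (2 * R)))) + Real.exp (-(δ₀ / 2 * (((P.L : ℝ) ^ k)⁻¹ * R₁))) := by
      positivity
    calc B1.aSeq a P.L k ^ 2 * (c₀ * Real.exp (δ₀ / 2) * K) *
          (m * Real.exp (-(δ₀ * (((P.L : ℝ) ^ k)⁻¹ * (2 * R)))) + Real.exp (-(δ₀ / 2 * (((P.L : ℝ) ^ k)⁻¹ * R₁))))
        ≤ a ^ 2 * (c₀ * Real.exp (δ₀ / 2) * K) * (((Mmax : ℝ) + 1) * η) :=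
          mul_le_mul (mul_le_mul_of_nonneg_right h1 h3) h2 h4 (by positivity)
      _ = B * η := by rw [hB]; ring
      _ ≤ cS / 8 := by
          rw [hη, mul_div_assoc', div_le_div_iff₀ (by positivity) (by norm_num : (0 : ℝ) < 8)]
          have e8 : cS * (8 * (B + 1)) = B * cS * 8 + 8 * cS := by ring
          rw [e8]; linarith only [hcS0.le]
  -- the (7.3.2) term `≤ cS/8`
  have hEm : 4 / 3 * (P.d : ℝ) ^ 4 * (2 * creg * ec ^ β) ^ 2 ≤ cS / 8 := by
    rw [hdr, ← hZd]
    calc Zd * (2 * creg * ec ^ β) ^ 2 ≤ Zd * θ₀ := mul_le_mul_of_nonneg_left hθ hZd0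
      _ ≤ cS / 8 := by
          rw [hθ₀, mul_div_assoc', div_le_div_iff₀ (by positivity) (by norm_num : (0 : ℝ) < 8)]
          have e8 : cS * (8 * (Zd + 1)) = Zd * cS * 8 + 8 * cS := by ring
          rw [e8]; linarith only [hcS0.le]
  -- `hE` of gen 21's member, `σ = ½`
  have hE : 4 / 3 * (P.d : ℝ) ^ 4 * (2 * creg * ec ^ β) ^ 2 +
      B1.aSeq a P.L k ^ 2 * (c₀ * Real.exp (1 / (8 * (P.L : ℝ) ^ s) / 2) * latticeConst P.d (1 / (8 * (P.L : ℝ) ^ s) / 2)) *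
        (m * Real.exp (-(1 / (8 * (P.L : ℝ) ^ s) * (((P.L : ℝ) ^ k)⁻¹ * (2 * R)))) +
          Real.exp (-(1 / (8 * (P.L : ℝ) ^ s) / 2 * (((P.L : ℝ) ^ k)⁻¹ * R₁)))) <
      c240 P (min (a / (9 * (P.d + 1))) (1 / 12)) κ' * (1 - 1 / 2) := by
    rw [hKP, ← hδ₀, hcSP]; linarith only [hBr, hEm, hcS0]
  -- the walk-expansion weight `≤ W_max` and `hsmall`
  have hWle : 4 / δ₀ * (2 * K) * (B1.aSeq a P.L k * (1 + m * B1.aSeq a P.L k * (c₀ * Real.exp δ₀)) +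
      κ' * (((P.L : ℝ) ^ P.d)⁻¹) ^ 2 * Real.exp (δ₀ * ((P.L : ℝ) - 1))) ≤ Wm := by
    rw [hWm, hPd]
    have h11 : m * B1.aSeq a P.L k ≤ (Mmax : ℝ) * a := mul_le_mul hm hak_le hak0.le (Nat.cast_nonneg _)
    have h12 : 0 ≤ 1 + m * B1.aSeq a P.L k * (c₀ * Real.exp δ₀) := by positivity
    have h1 : B1.aSeq a P.L k * (1 + m * B1.aSeq a P.L k * (c₀ * Real.exp δ₀)) ≤ a * (1 + (Mmax : ℝ) * a * (c₀ * Real.exp δ₀)) :=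
      calc B1.aSeq a P.L k * (1 + m * B1.aSeq a P.L k * (c₀ * Real.exp δ₀))
          ≤ a * (1 + m * B1.aSeq a P.L k * (c₀ * Real.exp δ₀)) := mul_le_mul_of_nonneg_right hak_le h12
        _ ≤ a * (1 + (Mmax : ℝ) * a * (c₀ * Real.exp δ₀)) := by
            refine mul_le_mul_of_nonneg_left ?_ ha.le
            have := mul_le_mul_of_nonneg_right h11 (show 0 ≤ c₀ * Real.exp δ₀ by positivity)
            linarith only [this]
    exact mul_le_mul_of_nonneg_left (add_le_add h1 le_rfl) (by positivity)
  have hsmall : ϑ * ((4 / (1 / (8 * (P.L : ℝ) ^ s))) * (2 * latticeConst P.d (1 / (8 * (P.L : ℝ) ^ s) / 2)) *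
      (B1.aSeq a P.L k * (1 + m * B1.aSeq a P.L k * (c₀ * Real.exp (1 / (8 * (P.L : ℝ) ^ s)))) +
        κ' * (((P.L : ℝ) ^ P.d)⁻¹) ^ 2 * Real.exp (1 / (8 * (P.L : ℝ) ^ s) * ((P.L : ℝ) - 1)))) ≤
      (c240 P (min (a / (9 * (P.d + 1))) (1 / 12)) κ' * (1 - 1 / 2) -
        (4 / 3 * (P.d : ℝ) ^ 4 * (2 * creg * ec ^ β) ^ 2 +
          B1.aSeq a P.L k ^ 2 * (c₀ * Real.exp (1 / (8 * (P.L : ℝ) ^ s) / 2) * latticeConst P.d (1 / (8 * (P.L : ℝ) ^ s) / 2)) *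
            (m * Real.exp (-(1 / (8 * (P.L : ℝ) ^ s) * (((P.L : ℝ) ^ k)⁻¹ * (2 * R)))) +
              Real.exp (-(1 / (8 * (P.L : ℝ) ^ s) / 2 * (((P.L : ℝ) ^ k)⁻¹ * R₁)))))) / 2 := by
    have h1 : ϑ * Wm ≤ cS / 8 := by
      calc ϑ * Wm ≤ cS / (8 * (Wm + 1)) * Wm := mul_le_mul_of_nonneg_right hϑW hWm0
        _ ≤ cS / 8 := by
            rw [div_mul_eq_mul_div, div_le_div_iff₀ (by positivity) (by norm_num : (0 : ℝ) < 8)]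
            have e8 : cS * (8 * (Wm + 1)) = cS * Wm * 8 + 8 * cS := by ring
            rw [e8]; linarith only [hcS0.le]
    have h2 := mul_le_mul_of_nonneg_left hWle hϑ0.le
    rw [hKP, ← hδ₀, hcSP]
    linarith only [h1, h2, hBr, hEm]
  have hϑ4' : ϑ ≤ 1 / (8 * (P.L : ℝ) ^ s) / 4 := by rw [← hδ₀]; exact hϑ4
  -- gen 21's member at `σ = ½`, `κ′ = κ̂`, and the final constant `4/(c_S/2 − E) ≤ 16/c_S`
  have hmain := M P hPd rfl k hk1 hkK hks hk' hsize A ec hec hece hreg c M0 hfit0 sg W hsg R R₀ R₁ hRm hR₁ hR10 hW hgap Λ hΛ T₁ δ'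
    (1 / 2) hInt hTree hσ κ' hκ'.le hE ϑ hϑ0.le hϑ4' hsmall x₁ x₂
  refine hmain.trans ?_
  have he0 : 0 ≤ Real.exp (-(ϑ * B5Ineq137Torus.T P (0 + k) x₁ x₂)) := (Real.exp_pos _).le
  have hα : 0 < B1RG242Torus.α P a k := mul_pos hak0 (inv_pos.mpr (pow_pos (P.spacing_pos k) 2))
  have hA0 : 0 ≤ ((B1RG242Torus.α P a k * (P.L : ℝ) ^ (k * P.d)) / B1.aSeq a P.L k)⁻¹ :=
    (inv_pos.2 (div_pos (mul_pos hα (pow_pos P.cast_L_pos _)) hak0)).le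
  have hc : 4 / (c240 P (min (a / (9 * (P.d + 1))) (1 / 12)) κ' * (1 - 1 / 2) -
      (4 / 3 * (P.d : ℝ) ^ 4 * (2 * creg * ec ^ β) ^ 2 +
        B1.aSeq a P.L k ^ 2 * (c₀ * Real.exp (1 / (8 * (P.L : ℝ) ^ s) / 2) * latticeConst P.d (1 / (8 * (P.L : ℝ) ^ s) / 2)) *
          (m * Real.exp (-(1 / (8 * (P.L : ℝ) ^ s) * (((P.L : ℝ) ^ k)⁻¹ * (2 * R)))) +
            Real.exp (-(1 / (8 * (P.L : ℝ) ^ s) / 2 * (((P.L : ℝ) ^ k)⁻¹ * R₁)))))) ≤ 16 / cS := by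
    rw [hKP, ← hδ₀, hcSP]
    have hgap' : cS / 4 ≤ cS * (1 - 1 / 2) - (4 / 3 * (P.d : ℝ) ^ 4 * (2 * creg * ec ^ β) ^ 2 +
        B1.aSeq a P.L k ^ 2 * (c₀ * Real.exp (δ₀ / 2) * K) *
          (m * Real.exp (-(δ₀ * (((P.L : ℝ) ^ k)⁻¹ * (2 * R)))) + Real.exp (-(δ₀ / 2 * (((P.L : ℝ) ^ k)⁻¹ * R₁))))) := by
      linarith only [hBr, hEm]
    calc _ ≤ 4 / (cS / 4) := div_le_div_of_nonneg_left (by norm_num) (by positivity) hgap'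
      _ = 16 / cS := by rw [div_div_eq_mul_div]; ring
  exact mul_le_mul_of_nonneg_right (mul_le_mul_of_nonneg_left hc hA0) he0


/-! ## §2 (2.40) and (4.9)_{j≥1} with the constants chosen before the instance (v1.1, append-only) -/

open BIJ88Decay241RegularTorusCwt (Z49_regular_torus_cwt)
open BIJ88Eq240FlatTorus (realify)
open BIJ88Normalization46 (Z49)

/-- **(2.40) AND (4.9)_{j≥1} FOR `Δ_{k,loc}(e^{ieεA})`, `Ω = T_η`, AT A (2.23)-REGULAR `A`, FOR THE PRINTED DATA WITH BIG-BLOCK CUBES — CONSTANTS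
CHOSEN BEFORE THE INSTANCE** (p. 264: *"We define C^{(k)}_Λ(u) = […]^{−1}. (2.40) … by (2.38), C^{(k)}_Λ(u)^{−1} is bounded below"*; p. 275 (4.9): the Gaussian normalization
`Z^{(j)}_Λ`, `j ≥ 1`).  `∃ s₀`, `∀ s ≥ s₀`, `∃ e₁ θ₀ ρ₀ > 0` (from `(d, L, a, e, c, β, κ̂, M_max, s)` only) such that, under the data of
`decay241_regular_torus_cwt_uniform` without the decay-rate smallness (torus, level, `A` (2.23)-regular with `0 < e_k ≤ e₁`, `(2c·e_k^β)² ≤ θ₀`,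
reference box, `s_g ≥ 1`, `W`, radii `R ≥ rowMargin + ρ₀L^k`, `ρ₀L^k ≤ R₁ < R₀`, multiplicity `≤ M_max`, deep `Λ`, averaged-field smallness with
`σ = ½`), for all `E_s, N`: `realify((Δ_{k,loc}(u) + (A/a_k)κ̂P(u_k))|_Λ)` IS POSITIVE DEFINITE, `Z^{(k)}_Λ = e^{−E_sN}(2π)^{#(Λ×2)/2}/√det(…)` and
`Z^{(k)}_Λ > 0`, `u = e^{ieεA}` — gen 21's `Z49_regular_torus_cwt` BY NAME with `σ = ½`, `κ′ = κ̂`, its largeness condition `hE` discharged by the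
thresholds. [cite: BalabanImbrieJaffe1988, (2.40) p.264] [cite: BalabanImbrieJaffe1988, (4.9) p.275] -/
theorem Z49_regular_torus_cwt_uniform (d L : ℕ) (hL : 2 ≤ L) {a : ℝ} (ha : 0 < a) (e creg β : ℝ) (hcreg : 0 ≤ creg)
    (hβ : 0 < β) {κ' : ℝ} (hκ' : 0 < κ') (Mmax : ℕ) :
    ∃ s₀ : ℕ, ∀ s : ℕ, s₀ ≤ s → ∃ e₁ θ₀ ρ₀ : ℝ, 0 < e₁ ∧ 0 < θ₀ ∧ 0 < ρ₀ ∧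
      ∀ (P : Params) (hPd : P.d = d + 1), P.L = L → ∀ (k : ℕ), 1 ≤ k → k ≤ P.K → k + s ≤ P.m + P.K → k + 1 ≤ P.m + P.K →
      3 * (L ^ k * L ^ s) ≤ P.sitesPerDir 0 →
      ∀ (A : PBond P 0 → ℝ) (ec : ℝ), 0 < ec → ec ≤ e₁ →
      (∀ (z : Balaban1983to89.Site P 0) (μ ν : Fin P.d),
          P.spacing k * |e| / ec * |A ⟨z.shift μ, ν⟩ - A ⟨z, ν⟩| ≤ creg * ec ^ (β - 1) / (L : ℝ) ^ k) →
      (2 * creg * ec ^ β) ^ 2 ≤ θ₀ →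
      ∀ (c M0 : Fin (d + 1) → ℕ), (∀ i, c i * P.L ^ k + P.L ^ k * M0 i ≤ P.sitesPerDir 0) →
      ∀ (sg W : ℕ), 1 ≤ sg → ∀ (R R₀ R₁ : ℝ), ((rowMargin L (d + 1) k s : ℕ) : ℝ) + ρ₀ * (L : ℝ) ^ k ≤ R → ρ₀ * (L : ℝ) ^ k ≤ R₁ →
        R₁ < R₀ → ((⌊(((P.L : ℝ) ^ k) - 1 + R₀) / sg⌋₊ + 3) ^ (d + 1) ≤ Mmax) →
        2 * (sg : ℝ) / 3 + R₀ / 2 + R ≤ W → (∀ i, ((P.L ^ k * M0 i : ℕ) : ℝ) + R ≤ P.sitesPerDir 0) →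
      ∀ (Λ : Finset (Balaban1983to89.Site P (0 + k))),
        (∀ y₁ ∈ Λ, ∀ μ, (c (Fin.cast hPd μ) : ℝ) * P.L ^ k + (R₀ + R) ≤ (P.L : ℝ) ^ k * (y₁ μ).val ∧
          (P.L : ℝ) ^ k * (y₁ μ).val + P.L ^ k + (R₀ + R) ≤ (c (Fin.cast hPd μ) : ℝ) * P.L ^ k + (P.L : ℝ) ^ k * M0 (Fin.cast hPd μ)) →
      ∀ (T₁ δ' : ℝ),
        (∀ b : PBond P (0 + k), blkIter 1 b.src = blkIter 1 b.tgt → ‖toC (lineIter (expGauge P e A) k b) - 1‖ ≤ T₁) →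
        (∀ y : Balaban1983to89.Site P (0 + k), ‖holCK (lineIter (expGauge P e A) k) 1 y - 1‖ ≤ δ') →
        2 * (((P.L : ℝ) - 1) * P.L) * P.d * T₁ ^ 2 + 2 * δ' ^ 2 ≤ 1 / 2 →
      ∀ (Es N : ℝ),
        (realify (compress Λ (op240 (deltaLocT (B1RG242Torus.α P a k * (P.L : ℝ) ^ (k * P.d)) P.eps⁻¹ (expGauge P e A) k
            (cubeFamB hPd (P.L ^ k) c M0 sg W (L ^ k * L ^ s)) (lamFam hPd (P.L ^ k) c M0 sg) (cutoff R₁ R₀ (B5Ineq137Torus.T P 0)))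
            ((B1RG242Torus.α P a k * (P.L : ℝ) ^ (k * P.d)) / B1.aSeq a P.L k * κ') (lineIter (expGauge P e A) k)))).PosDef ∧
        Z49 (realify (compress Λ (op240 (deltaLocT (B1RG242Torus.α P a k * (P.L : ℝ) ^ (k * P.d)) P.eps⁻¹ (expGauge P e A) k
            (cubeFamB hPd (P.L ^ k) c M0 sg W (L ^ k * L ^ s)) (lamFam hPd (P.L ^ k) c M0 sg) (cutoff R₁ R₀ (B5Ineq137Torus.T P 0)))
            ((B1RG242Torus.α P a k * (P.L : ℝ) ^ (k * P.d)) / B1.aSeq a P.L k * κ') (lineIter (expGauge P e A) k)))) Es N =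
          Real.exp (-(Es * N)) * (Real.sqrt (2 * Real.pi) ^ Fintype.card (↥Λ × Fin 2) /
            Real.sqrt (realify (compress Λ (op240 (deltaLocT (B1RG242Torus.α P a k * (P.L : ℝ) ^ (k * P.d)) P.eps⁻¹ (expGauge P e A) k
              (cubeFamB hPd (P.L ^ k) c M0 sg W (L ^ k * L ^ s)) (lamFam hPd (P.L ^ k) c M0 sg) (cutoff R₁ R₀ (B5Ineq137Torus.T P 0)))
              ((B1RG242Torus.α P a k * (P.L : ℝ) ^ (k * P.d)) / B1.aSeq a P.L k * κ') (lineIter (expGauge P e A) k)))).det) ∧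
        0 < Z49 (realify (compress Λ (op240 (deltaLocT (B1RG242Torus.α P a k * (P.L : ℝ) ^ (k * P.d)) P.eps⁻¹ (expGauge P e A) k
            (cubeFamB hPd (P.L ^ k) c M0 sg W (L ^ k * L ^ s)) (lamFam hPd (P.L ^ k) c M0 sg) (cutoff R₁ R₀ (B5Ineq137Torus.T P 0)))
            ((B1RG242Torus.α P a k * (P.L : ℝ) ^ (k * P.d)) / B1.aSeq a P.L k * κ') (lineIter (expGauge P e A) k)))) Es N := by
  obtain ⟨s₀, H⟩ := Z49_regular_torus_cwt d L hL ha e creg β hcreg hβ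
  refine ⟨s₀, fun s hs => ?_⟩
  obtain ⟨c₀, e₁, hc₀, he₁, M⟩ := H s hs
  clear H
  have hLr2 : (2 : ℝ) ≤ L := by exact_mod_cast hL
  have hL0 : (0 : ℝ) < L := by linarith
  have hLL : (0 : ℝ) < 2 * (((L : ℝ) - 1) * L) := by nlinarith only [hLr2]
  -- the constants (as in §1, without the decay-rate ones)
  obtain ⟨δ₀, hδ₀⟩ : ∃ x : ℝ, x = 1 / (8 * (L : ℝ) ^ s) := ⟨_, rfl⟩
  have hδ₀0 : 0 < δ₀ := by rw [hδ₀]; positivity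
  obtain ⟨g0, hg0⟩ : ∃ x : ℝ, x = min (a / (9 * ((d : ℝ) + 1 + 1))) (1 / 12) := ⟨_, rfl⟩
  have hg00 : 0 < g0 := by rw [hg0]; exact lt_min (by positivity) (by norm_num)
  obtain ⟨cS, hcS⟩ : ∃ x : ℝ, x = min (g0 / (2 * (((L : ℝ) - 1) * L))) (κ' / (2 * (L : ℝ) ^ (d + 1))) := ⟨_, rfl⟩
  have hcS0 : 0 < cS := by rw [hcS]; exact lt_min (div_pos hg00 hLL) (by positivity)
  obtain ⟨K, hK⟩ : ∃ x : ℝ, x = latticeConst (d + 1) (δ₀ / 2) := ⟨_, rfl⟩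
  have hK0 : 0 ≤ K := by rw [hK]; exact latticeConst_nonneg (d + 1) (half_pos hδ₀0).le
  obtain ⟨Zd, hZd⟩ : ∃ x : ℝ, x = 4 / 3 * ((d : ℝ) + 1) ^ 4 := ⟨_, rfl⟩
  have hZd0 : 0 ≤ Zd := by rw [hZd]; positivity
  obtain ⟨θ₀, hθ₀⟩ : ∃ x : ℝ, x = cS / (8 * (Zd + 1)) := ⟨_, rfl⟩
  have hθ₀0 : 0 < θ₀ := by rw [hθ₀]; positivity
  obtain ⟨B, hB⟩ : ∃ x : ℝ, x = a ^ 2 * (c₀ * Real.exp (δ₀ / 2) * K) * ((Mmax : ℝ) + 1) := ⟨_, rfl⟩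
  have hB0 : 0 ≤ B := by rw [hB]; positivity
  obtain ⟨η, hη⟩ : ∃ x : ℝ, x = cS / (8 * (B + 1)) := ⟨_, rfl⟩
  have hη0 : 0 < η := by rw [hη]; positivity
  obtain ⟨ρ₀, hρ₀⟩ : ∃ x : ℝ, x = 2 / δ₀ * (1 / η) := ⟨_, rfl⟩
  have hρ₀0 : 0 < ρ₀ := by rw [hρ₀]; positivity
  have h1η : 1 / η = δ₀ / 2 * ρ₀ := by rw [hρ₀]; field_simp
  refine ⟨e₁, θ₀, ρ₀, he₁, hθ₀0, hρ₀0, ?_⟩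
  intro P hPd hPL k hk1 hkK hks hk' hsize A ec hec hece hreg hθ c M0 hfit0 sg W hsg R R₀ R₁ hRρ hR₁ρ hR10 hMm hW hgap Λ hΛ T₁ δ'
    hInt hTree hσ Es N
  subst hPL
  have hdr : (P.d : ℝ) = (d : ℝ) + 1 := by rw [hPd]; push_cast; ring
  have hLk : (0 : ℝ) < (P.L : ℝ) ^ k := pow_pos hL0 k
  have hρL : 0 < ρ₀ * (P.L : ℝ) ^ k := mul_pos hρ₀0 hLk
  have hRm : ((rowMargin P.L (d + 1) k s : ℕ) : ℝ) < R := by linarith only [hRρ, hρL]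
  have hRρ' : ρ₀ * (P.L : ℝ) ^ k ≤ R := by
    linarith only [hRρ, (Nat.cast_nonneg _ : (0 : ℝ) ≤ (rowMargin P.L (d + 1) k s : ℕ))]
  have hR₁ : 0 ≤ R₁ := hρL.le.trans hR₁ρ
  have hak0 : 0 < B1.aSeq a P.L k := B1.aSeq_pos ha (B1RG242Torus.one_lt_cast_L P) hk1
  have hak_le : B1.aSeq a P.L k ≤ a := B1.aSeq_le ha (B1RG242Torus.one_lt_cast_L P) k hk1
  have hKP : latticeConst P.d (1 / (8 * (P.L : ℝ) ^ s) / 2) = K := by rw [hK, hPd, hδ₀]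
  have hcSP : c240 P (min (a / (9 * (P.d + 1))) (1 / 12)) κ' = cS := by rw [c240, hcS, hg0, hdr, hPd]
  have hm : ((⌊(((P.L : ℝ) ^ k) - 1 + R₀) / sg⌋₊ : ℝ) + 3) ^ (d + 1) ≤ (Mmax : ℝ) := by exact_mod_cast hMm
  set m : ℝ := ((⌊(((P.L : ℝ) ^ k) - 1 + R₀) / sg⌋₊ : ℝ) + 3) ^ (d + 1) with hmdef
  have hm0 : 0 ≤ m := by rw [hmdef]; positivity
  -- the (2.35) bracket `≤ cS/8` and the (7.3.2) term `≤ cS/8`, as in §1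
  have hexp2 : Real.exp (-(δ₀ * (((P.L : ℝ) ^ k)⁻¹ * (2 * R)))) ≤ η := by
    refine exp_neg_le_of_inv_le hη0 ?_
    have h2 : ρ₀ ≤ ((P.L : ℝ) ^ k)⁻¹ * (2 * R) := by
      rw [inv_mul_eq_div, le_div_iff₀ hLk]; linarith only [hRρ', hρL]
    rw [h1η]
    have h3 := mul_le_mul_of_nonneg_left h2 hδ₀0.le
    linarith only [h3, mul_pos hδ₀0 hρ₀0]
  have hexp1 : Real.exp (-(δ₀ / 2 * (((P.L : ℝ) ^ k)⁻¹ * R₁))) ≤ η := by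
    refine exp_neg_le_of_inv_le hη0 ?_
    have h2 : ρ₀ ≤ ((P.L : ℝ) ^ k)⁻¹ * R₁ := by
      rw [inv_mul_eq_div, le_div_iff₀ hLk]; exact hR₁ρ
    rw [h1η]
    exact mul_le_mul_of_nonneg_left h2 (by positivity)
  have hBr : B1.aSeq a P.L k ^ 2 * (c₀ * Real.exp (δ₀ / 2) * K) *
      (m * Real.exp (-(δ₀ * (((P.L : ℝ) ^ k)⁻¹ * (2 * R)))) + Real.exp (-(δ₀ / 2 * (((P.L : ℝ) ^ k)⁻¹ * R₁)))) ≤ cS / 8 := by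
    have h1 : B1.aSeq a P.L k ^ 2 ≤ a ^ 2 := pow_le_pow_left₀ hak0.le hak_le 2
    have h2 : m * Real.exp (-(δ₀ * (((P.L : ℝ) ^ k)⁻¹ * (2 * R)))) + Real.exp (-(δ₀ / 2 * (((P.L : ℝ) ^ k)⁻¹ * R₁))) ≤
        ((Mmax : ℝ) + 1) * η :=
      (add_le_add (mul_le_mul hm hexp2 (Real.exp_pos _).le (Nat.cast_nonneg _)) hexp1).trans_eq (by ring)
    have h3 : 0 ≤ c₀ * Real.exp (δ₀ / 2) * K := by positivity
    have h4 : 0 ≤ m * Real.exp (-(δ₀ * (((P.L : ℝ) ^ k)⁻¹ * (2 * R)))) + Real.exp (-(δ₀ / 2 * (((P.L : ℝ) ^ k)⁻¹ * R₁))) := by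
      positivity
    calc B1.aSeq a P.L k ^ 2 * (c₀ * Real.exp (δ₀ / 2) * K) *
          (m * Real.exp (-(δ₀ * (((P.L : ℝ) ^ k)⁻¹ * (2 * R)))) + Real.exp (-(δ₀ / 2 * (((P.L : ℝ) ^ k)⁻¹ * R₁))))
        ≤ a ^ 2 * (c₀ * Real.exp (δ₀ / 2) * K) * (((Mmax : ℝ) + 1) * η) :=
          mul_le_mul (mul_le_mul_of_nonneg_right h1 h3) h2 h4 (by positivity)
      _ = B * η := by rw [hB]; ring
      _ ≤ cS / 8 := by
          rw [hη, mul_div_assoc', div_le_div_iff₀ (by positivity) (by norm_num : (0 : ℝ) < 8)]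
          have e8 : cS * (8 * (B + 1)) = B * cS * 8 + 8 * cS := by ring
          rw [e8]; linarith only [hcS0.le]
  have hEm : 4 / 3 * (P.d : ℝ) ^ 4 * (2 * creg * ec ^ β) ^ 2 ≤ cS / 8 := by
    rw [hdr, ← hZd]
    calc Zd * (2 * creg * ec ^ β) ^ 2 ≤ Zd * θ₀ := mul_le_mul_of_nonneg_left hθ hZd0
      _ ≤ cS / 8 := by
          rw [hθ₀, mul_div_assoc', div_le_div_iff₀ (by positivity) (by norm_num : (0 : ℝ) < 8)]
          have e8 : cS * (8 * (Zd + 1)) = Zd * cS * 8 + 8 * cS := by ring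
          rw [e8]; linarith only [hcS0.le]
  have hE : 4 / 3 * (P.d : ℝ) ^ 4 * (2 * creg * ec ^ β) ^ 2 +
      B1.aSeq a P.L k ^ 2 * (c₀ * Real.exp (1 / (8 * (P.L : ℝ) ^ s) / 2) * latticeConst P.d (1 / (8 * (P.L : ℝ) ^ s) / 2)) *
        (m * Real.exp (-(1 / (8 * (P.L : ℝ) ^ s) * (((P.L : ℝ) ^ k)⁻¹ * (2 * R)))) +
          Real.exp (-(1 / (8 * (P.L : ℝ) ^ s) / 2 * (((P.L : ℝ) ^ k)⁻¹ * R₁)))) <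
      c240 P (min (a / (9 * (P.d + 1))) (1 / 12)) κ' * (1 - 1 / 2) := by
    rw [hKP, ← hδ₀, hcSP]; linarith only [hBr, hEm, hcS0]
  exact M P hPd rfl k hk1 hkK hks hk' hsize A ec hec hece hreg c M0 hfit0 sg W hsg R R₀ R₁ hRm hR₁ hR10 hW hgap Λ hΛ T₁ δ' (1 / 2)
    hInt hTree hσ κ' hκ'.le hE Es N

end

end Literature.MathematicalPhysics.QuantumFieldTheory.BalabanImbrieJaffe1984to88.BIJ88Decay241RegularTorusCwtUniform
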